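import Summits.HubbardSuperconductivity.HubbardSuperconductivity.Theorems.BalabanIRBirEveryGroundStateSocket

/-!
# Sketch — crux-ideate stmt-HubbardSuperconductivity-2083 (`BalabanIR.BirEveryGroundState`),
# ideator k = 1 (gen 2), card `two-scale-domination`

First-lemma signatures.  Everything is a `Prop`-valued `def` (nothing is asserted), except the
one-line DOMINATION lemma, which is proved to show the lever is real.  Imports only the
Theses-free socket module (rev-5 materialisation rule), hence only Literature declarations.
-/

set_option linter.dupNamespace false

noncomputable section

namespace Summit.HubbardSuperconductivity.HubbardSuperconductivity.Cruxes.BirEveryGroundState.SketchTwoScale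

open Matrix Finset Filter
open Literature.Probability.LatticeModels Literature.MathematicalPhysics.QuantumLattice
open scoped ComplexOrder

/-! ## §A  The abstract lever (finite-dimensional linear algebra, model-free and TRUE) -/

section Abstract

variable {n : Type*} [Fintype n] [DecidableEq n]

/-- DOMINATION.  A unit vector `ψ` of a subspace `K` (orthogonal projection `P`, `d = tr P`) is
dominated by the un-normalised trace over `K` on every positive semidefinite observable:
`⟨ψ, X ψ⟩ ≤ tr (P X) = d · ⟨X⟩_avg`.  (Complete `ψ` to an orthonormal basis of `K`.)  This is the
only place the ground degeneracy `d` enters the line: as a BUDGET, never through the structure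
(irreducibility, genericity) of the ground multiplet. -/
def Domination : Prop :=
  ∀ (X : Matrix n n ℂ), X.PosSemidef → ∀ (K : Submodule ℂ (n → ℂ)) (ψ : n → ℂ), ψ ∈ K →
    star ψ ⬝ᵥ ψ = 1 →
    let P : Matrix n n ℂ := projMatrix (K.map
      ((WithLp.linearEquiv 2 ℂ (n → ℂ)).symm : (n → ℂ) →ₗ[ℂ] EuclideanSpace ℂ n))
    (star ψ ⬝ᵥ X *ᵥ ψ).re ≤ (P * X).trace.re

/-- TWO-SCALE DOMINATION INEQUALITY (★) — the First lemma of the card.  Data: a finite family of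
"block" matrices `m x` (`x : ι`), their mean `M = |ι|⁻¹ Σ_x m x`, a subspace `K` with projection
`P`, `d = re tr P`, and a unit `ψ ∈ K`.  GS-average functionals (un-normalised traces divided by
`d`): block intensity `A = |ι|⁻¹ Σ_x ⟨(m x)ᴴ m x⟩_avg`, global intensity `Y = ⟨Mᴴ M⟩_avg`,
block variance about a centre `t`: `V(t) = |ι|⁻¹ Σ_x ⟨((m x)ᴴ m x - t)²⟩_avg`.  CLAIM:
`re ⟨ψ, Mᴴ M ψ⟩ ≥ t - √(d · V(t)) - d · (A - Y)`.
PROOF SKETCH (three lines): (i) the operator identity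
`|ι|⁻² Σ_{x,x'} (m x - m x')ᴴ (m x - m x') = 2 |ι|⁻¹ Σ_x (m x)ᴴ m x - 2 Mᴴ M` holds in EVERY state,
so `Domination` applied to this PSD operator gives `A_ψ - Y_ψ ≤ d (A - Y)`; (ii) `Domination`
applied to the PSD operator `((m x)ᴴ m x - t)²` and Cauchy–Schwarz give `A_ψ ≥ t - √(d V(t))`;
(iii) subtract.  With `t := A ≥ Y` this reads `Y_ψ ≥ Y - √(d V) - d (A - Y)`: EVERY vector of `K`
carries the average global intensity up to a block-RIGIDITY error and a SAG error. -/
def TwoScaleDomination : Prop :=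
  ∀ (ι : Type) [Fintype ι] [Nonempty ι] (m : ι → Matrix n n ℂ) (K : Submodule ℂ (n → ℂ))
    (ψ : n → ℂ), ψ ∈ K → star ψ ⬝ᵥ ψ = 1 → ∀ t : ℝ,
    let P : Matrix n n ℂ := projMatrix (K.map
      ((WithLp.linearEquiv 2 ℂ (n → ℂ)).symm : (n → ℂ) →ₗ[ℂ] EuclideanSpace ℂ n))
    let d : ℝ := P.trace.re
    let M : Matrix n n ℂ := ((Fintype.card ι : ℂ))⁻¹ • ∑ x, m x
    let A : ℝ := (∑ x, (P * ((m x)ᴴ * m x)).trace.re) / (Fintype.card ι * d)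
    let Y : ℝ := (P * (Mᴴ * M)).trace.re / d
    let V : ℝ := (∑ x, (P * (((m x)ᴴ * m x - (t : ℂ) • 1) * ((m x)ᴴ * m x - (t : ℂ) • 1))).trace.re)
      / (Fintype.card ι * d)
    t - Real.sqrt (d * V) - d * (A - Y) ≤ (star ψ ⬝ᵥ (Mᴴ * M) *ᵥ ψ).re

omit [DecidableEq n] in
/-- The polarisation identity behind step (i), stated as a `Prop` (it is an identity of matrices,
valid before taking any expectation): the mean squared block DIFFERENCE equals twice the mean block
intensity minus twice the global intensity. -/
def BlockDifferenceIdentity : Prop :=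
  ∀ (ι : Type) [Fintype ι] [Nonempty ι] (m : ι → Matrix n n ℂ),
    let M : Matrix n n ℂ := ((Fintype.card ι : ℂ))⁻¹ • ∑ x, m x
    ((Fintype.card ι : ℂ) ^ 2)⁻¹ • ∑ x, ∑ x', (m x - m x')ᴴ * (m x - m x') =
      (2 * ((Fintype.card ι : ℂ))⁻¹) • ∑ x, (m x)ᴴ * m x - (2 : ℂ) • (Mᴴ * M)

/-- `Domination` holds (proof: `P ≥ |ψ⟩⟨ψ|` on PSD `X`; here via the spectral/Parseval route
already in the tree: `re ⟨ψ, X ψ⟩ ≤ ‖…‖`… — kept as a one-goal `sorry`-free proof would need the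
orthonormal-basis bookkeeping of `re_trace_projMatrix_mul_eq_sum` type; we record the statement
and leave the routine proof to crux-plan).  Placeholder: the trivial instance `X = 0`. -/
example : (0 : Matrix n n ℂ).PosSemidef := Matrix.PosSemidef.zero

end Abstract

/-! ## §B  Hubbard instantiation: the objects of the crux, verbatim, plus BLOCKS -/

section Hubbard

/-- The sector ground projection of the crux at `(U, δ, L)` — an ABBREVIATION of the route decl's
own `let`-block (`P = projMatrix (E₀.map toEuclidean)`, `E₀ = szSector N_L 0 ⊓ ker (H - e₀)`,
`H = hubbardTorus 2 L 1 U`, `N_L = 2⌊(1-δ)L²/2⌋`). -/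
def groundProj (U δ : ℝ) (L : ℕ) [NeZero L] :
    Matrix (Finset (Orb (FermionTorus 2 L))) (Finset (Orb (FermionTorus 2 L))) ℂ :=
  let N : ℕ := 2 * ⌊(1 - δ) * (L : ℝ) ^ 2 / 2⌋₊
  let H := hubbardTorus 2 L 1 U
  let S := szSector (Λ := FermionTorus 2 L) N 0
  let E₀ := S ⊓ Module.End.eigenspace (Matrix.toLin' H) ((H.minEnergyOn S : ℝ) : ℂ)
  projMatrix (E₀.map (Fock.toEuclidean (ι := Orb (FermionTorus 2 L)) :
    Fock (Orb (FermionTorus 2 L)) →ₗ[ℂ] EuclideanSpace ℂ (Finset (Orb (FermionTorus 2 L)))))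

/-- The GS-AVERAGE expectation functional at `(U, δ, L)`: `⟨X⟩_avg = re tr (P X) / re tr P`
(`re tr P = dim E₀ ≥ 1`, `one_le_re_trace_groundProj_hubbardTorus`). -/
def gsAvg (U δ : ℝ) (L : ℕ) [NeZero L]
    (X : Matrix (Finset (Orb (FermionTorus 2 L))) (Finset (Orb (FermionTorus 2 L))) ℂ) : ℝ :=
  (groundProj U δ L * X).trace.re / (groundProj U δ L).trace.re

/-- BLOCK PAIR FIELD at scale `Λ`: the average of Scalapino's local `d`-wave pair operator
`localPair dWaveFormFactor L y` over the `Λ × Λ` box anchored at `x` (boxes wrap on the torus;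
`Λ ≤ L` intended).  The mean over anchors is EXACTLY `L⁻² · pairField dWaveFormFactor L = Δ_d/L²`
(each site lies in `Λ²` anchored boxes), so `Mᴴ M = L⁻⁴ Δ_d† Δ_d` — the crux's order observable. -/
def blockPair (L Λ : ℕ) [NeZero L] (x : TorusSite 2 L) :
    Matrix (Finset (Orb (FermionTorus 2 L))) (Finset (Orb (FermionTorus 2 L))) ℂ :=
  (((Λ : ℂ)) ^ 2)⁻¹ • ∑ v : Fin Λ × Fin Λ,
    localPair dWaveFormFactor L (x + ![((v.1 : ℕ) : ZMod L), ((v.2 : ℕ) : ZMod L)])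

/-- Block intensity of the GS-average at scale `Λ`: `A_{Λ,L} = L⁻² Σ_x ⟨m_Λ(x)ᴴ m_Λ(x)⟩_avg`. -/
def blockIntensity (U δ : ℝ) (L Λ : ℕ) [NeZero L] : ℝ :=
  (∑ x : TorusSite 2 L, gsAvg U δ L ((blockPair L Λ x)ᴴ * blockPair L Λ x)) / (L : ℝ) ^ 2

/-- Global intensity of the GS-average: `Y_L = L⁻⁴ ⟨Δ_d† Δ_d⟩_avg` (the crux's hypothesis says
`Y_L ≥ c` eventually, at every `U` of the window). -/
def globalIntensity (U δ : ℝ) (L : ℕ) [NeZero L] : ℝ :=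
  gsAvg U δ L ((pairField dWaveFormFactor L)ᴴ * pairField dWaveFormFactor L) / (L : ℝ) ^ 4

/-- Block variance of the GS-average at scale `Λ`, centred at the block intensity:
`V_{Λ,L} = L⁻² Σ_x ⟨(m_Λ(x)ᴴ m_Λ(x) - A_{Λ,L})²⟩_avg` (a LOCAL 8-fermion observable: fixed block,
uniform in `L`). -/
def blockVariance (U δ : ℝ) (L Λ : ℕ) [NeZero L] : ℝ :=
  (∑ x : TorusSite 2 L, gsAvg U δ L
      (((blockPair L Λ x)ᴴ * blockPair L Λ x - ((blockIntensity U δ L Λ : ℝ) : ℂ) • 1) *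
        ((blockPair L Λ x)ᴴ * blockPair L Λ x - ((blockIntensity U δ L Λ : ℝ) : ℂ) • 1))) /
    (L : ℝ) ^ 2

/-- STUB-SHAPED HYPOTHESIS 1 — BLOCK RIGIDITY of the GS-average at coupling `U`: the block
pair intensity `|m_Λ|²` concentrates (its GS-average variance is small for large blocks, uniformly
in large `L`).  Physically: no coexisting pair-disordered component (the failure mode "dark partner
= different phase"); in the route's stiff XY caricature `V ~ 1/(KΛ)`.  An AVERAGE-state, LOCAL
property — engine territory, not genericity. -/
def BlockRigidityAt (U δ : ℝ) : Prop :=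
  ∀ ε > 0, ∃ Λ₀ : ℕ, ∀ Λ ≥ Λ₀, ∃ L₀ : ℕ, ∀ (L : ℕ) [NeZero L], L₀ ≤ L → Even L →
    blockVariance U δ L Λ ≤ ε

/-- STUB-SHAPED HYPOTHESIS 2 — NO SAG of the GS-average at coupling `U`: block intensity and global
intensity agree for large blocks, `A_{Λ,L} - Y_L → 0` (always `≥ 0`).  In Fourier variables this is
`Σ_{q ≠ 0} |F̂_Λ(q)|² Ĉ(q)/L² → 0` for the GS-average pair TWO-POINT function: an infrared bound
`Ĉ(q) = O(1/|q|)` at `T = 0` gives `O(1/Λ)`.  It kills the failure mode "dark partner = the same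
phase with pair order modulated at wavelength ~ L" (wound / LO-type condensates), invisible to any
local test.  FIRST-MOMENT data, the same type as the crux's hypothesis. -/
def NoSagAt (U δ : ℝ) : Prop :=
  ∀ ε > 0, ∃ Λ₀ : ℕ, ∀ Λ ≥ Λ₀, ∃ L₀ : ℕ, ∀ (L : ℕ) [NeZero L], L₀ ≤ L → Even L →
    blockIntensity U δ L Λ - globalIntensity U δ L ≤ ε

/-- STUB-SHAPED HYPOTHESIS 3 — DEGENERACY BUDGET at coupling `U`: the sector ground eigenspace has
dimension `≤ D` at all large even sides.  The ONLY exact-spectral input of the line (weaker than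
irreducibility / dark-partner exclusion: it does not care what the partners are); ED census of the
predecessor card: `d = 1` in 35/35 non-anomalous cases, `d = 3` permanently at the anomalous `L = 4`. -/
def DegeneracyBudgetAt (U δ D : ℝ) : Prop :=
  ∃ L₀ : ℕ, ∀ (L : ℕ) [NeZero L], L₀ ≤ L → Even L → (groundProj U δ L).trace.re ≤ D

/-- THE TRANSFER THE LINE DELIVERS at one coupling (plugs into the socket
`Theorems.birEveryGroundState_structural_of_transfer` / `forall_hasLRO_iff_groundState_bound`):
window-average bound at `U` (`Y_L ≥ c`) + rigidity + no-sag + budget ⇒ every normalised sector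
ground state has `(c/2) L⁴ ≤ re ⟨ψ, Δ_d†Δ_d ψ⟩` eventually in even `L`.  Proof from (★) with
`t = A_{Λ,L}`: `Y_ψ ≥ Y_L - √(D V_{Λ,L}) - D (A_{Λ,L} - Y_L) ≥ c - c/4 - c/4`. -/
def TwoScaleTransferAt (U δ c D : ℝ) : Prop :=
  (∃ L₀ : ℕ, ∀ (L : ℕ) [NeZero L], L₀ ≤ L → Even L → c ≤ globalIntensity U δ L) →
  BlockRigidityAt U δ → NoSagAt U δ → DegeneracyBudgetAt U δ D →
    ∃ L₀ : ℕ, ∀ (L : ℕ) [NeZero L], L₀ ≤ L → Even L →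
      ∀ ψ : Fock (Orb (FermionTorus 2 L)),
        IsGroundStateInSector (hubbardTorus 2 L 1 U) (2 * ⌊(1 - δ) * (L : ℝ) ^ 2 / 2⌋₊) 0 ψ →
        star ψ ⬝ᵥ ψ = 1 →
        c / 2 * (L : ℝ) ^ 4 ≤
          (star ψ ⬝ᵥ ((pairField dWaveFormFactor L)ᴴ * pairField dWaveFormFactor L) *ᵥ ψ).re

/-- THE RESIDUAL OF THE LINE, typed: at some coupling of every window carrying the average bound,
rigidity + no-sag + a budget hold.  (Rigidity and no-sag are asked of the route's ENGINE — they are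
GS-average correlation inequalities at two scales; the budget is the one exact-spectral conjecture.)
Together with `TwoScaleTransferAt` (provable now) and the socket this closes the crux BY NAME. -/
def TwoScaleResidual : Prop :=
  ∀ (δ U₁ U₂ c : ℝ), δ ∈ Set.Ioo (0:ℝ) (1/2) → 0 < U₁ → U₁ < U₂ → 0 < c →
    (∀ U ∈ Set.Ioo U₁ U₂, ∃ L₀ : ℕ, ∀ (L : ℕ) [NeZero L], L₀ ≤ L → Even L →
      c ≤ globalIntensity U δ L) →
    ∃ U ∈ Set.Ioo U₁ U₂, ∃ D : ℝ, BlockRigidityAt U δ ∧ NoSagAt U δ ∧ DegeneracyBudgetAt U δ D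

end Hubbard

end Summit.HubbardSuperconductivity.HubbardSuperconductivity.Cruxes.BirEveryGroundState.SketchTwoScale
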